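import Summits.AtomisticToContinuum.HydrodynamicLimit.Theses.JParityClosure
import Literature.MathematicalPhysics.KineticTheory.EvenCollisionTubeFunctional
import Literature.MathematicalPhysics.KineticTheory.MicroscaleWindowFunctionals
import Literature.MathematicalPhysics.KineticTheory.EvenStatTruncationBound
import Summits.AtomisticToContinuum.HydrodynamicLimit.Theorems.JParityClosureEvenStressEnskogClusterTransport
import Summits.AtomisticToContinuum.HydrodynamicLimit.Theorems.JParityClosureEvenStressEnskogMicroStationarity
import Summits.AtomisticToContinuum.HydrodynamicLimit.Theorems.JParityClosureEvenStressEnskogEnskogPointwise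
import Summits.AtomisticToContinuum.HydrodynamicLimit.Theorems.JParityClosureEvenStressEnskogEnskogIdentification
import HarnessLib

/-!
# `EvenStressEnskog` from the two standard second-moment local-equilibrium statements
# (line `stationary-microscale-hierarchy-entrance-law` of the crux `JParityClosure.EvenStressEnskog`,
# stmt-AtomisticToContinuum-13079 — the line's IDENTIFICATION and FREEZE halves, now theorems)

Definition-free, importable record of what the line has PROVED about the crux (lead c4; the skeleton
`Cruxes/EvenStressEnskog/Lines/stationary_microscale_hierarchy_entrance_law.lean` carries the same
statements as named `Prop`s — `ContactSideTested`, `EnskogSideTested`, `OneBodyMaxwellTested` (L1),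
`ContactMaxwellTested` (L2), `MicroStationarity` — which a Theorems file cannot import, so they are
SPELLED OUT here as hypotheses / conclusions):

* `evenStressEnskog_of_sides` — the crux from its CONTACT SIDE (collision sum of the even marks
  `Ξ_P^{kl}` ≈ the fully Maxwellian Enskog prediction `contactPredM`) and its ENSKOG SIDE
  (`contactPredM` ≈ the crux's own empirical Enskog term `σ³∫₀^τ enskogRate`), by the union bound
  `{η < |K − E|} ⊆ {η/2 < |K − C|} ∪ {η/2 < |C − E|}` pair by pair and a 9-fold `min r₀ / max N₀`;
* `evenStressEnskog_of_localGibbsTested` — **the crux from (L1) ∧ (L2)**: (L1) one-body local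
  Maxwellianity at scale `r` tested on second-moment test functions `|F(v,u,θ)| ≤ C(1+‖v‖²+‖u‖²+|θ|)`,
  and (L2) the Enskog contact law with the thermodynamic contact value and Maxwellian velocities for
  continuous second-moment marks `|Ξ(n,v,w)| ≤ C(1+‖v‖²+‖w‖²)`; the Enskog side is (L1) applied to the
  weight `g·Ỹ·a` and the test functions `F_{kl} = ∫_{S²}⟪v−u,ω⟫²ω_kω_l dσ` through the exact pointwise
  second-moment identity (`stub_enskogPointwise`, p127996) and the integrability bookkeeping
  (`stub_enskogIdentification_of_pointwise`, p134407); the contact side is the instance `Ξ := Ξ_P^{kl}`;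
* `contactSide_of_evenStressEnskog_of_enskogSide` — conversely, the crux AND the Enskog side give the
  contact side: modulo (L1) (for the weight `g·Ỹ·a` and the six `F_{kl}`) the crux IS the Enskog contact law
  for its even marks;
* `microStationarity` — **MICROSCALE STATIONARITY, unconditionally**: along the hard-sphere flow from
  local Gibbs data every time-and-`χ`-averaged microscale window statistic is weakly stationary in
  probability, `P_LG(η < |streamStat + collJump|) ≤ δ` for `N ≥ N₀`, every level, every fixed `r`
  (`stub_microStationarity_of`, p133940, applied to the cluster transport identity `stub_clusterTransport`,
  p126746).

What remains OPEN of the line is exactly the production of (L1) ∧ (L2) at positive times (its ARRIVAL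
CHAOS bet, RIGIDITY engine and a-priori tails); (L2) for the even marks is the two-body contact content
of the crux (Disproof.lean §6.3), (L1) its one-body half.

References: Chapman–Cowling (1970) Ch. 16; H. Spohn (1991) Part I §3.2; van Beijeren–Ernst (1973).
-/

noncomputable section

namespace Summit.AtomisticToContinuum.HydrodynamicLimit.Theorems.EvenStressEnskog

open scoped BigOperators InnerProductSpace Topology ENNReal
open MeasureTheory Filter Set
open Literature.MathematicalPhysics.KineticTheory Literature.Analysis.FluidPDE
open Literature.MathematicalPhysics.KineticTheory.StationaryMicroscale
open Summit.AtomisticToContinuum.HydrodynamicLimit.Theses.JParityClosure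

/-- The 9-fold min/max: per-pair thresholds `r₀(k,l) > 0`, `N₀(k,l,r)` give uniform ones over
`Fin 3 × Fin 3`. [folklore] -/
theorem lgr_exists_r₀_N₀_forall_fin3 {P : Fin 3 → Fin 3 → ℝ → ℕ → Prop}
    (h : ∀ k l, ∃ r₀ : ℝ, 0 < r₀ ∧ ∀ r : ℝ, 0 < r → r < r₀ → ∃ N₀ : ℕ, ∀ N : ℕ, N₀ ≤ N → P k l r N) :
    ∃ r₀ : ℝ, 0 < r₀ ∧ ∀ r : ℝ, 0 < r → r < r₀ → ∃ N₀ : ℕ, ∀ N : ℕ, N₀ ≤ N → ∀ k l, P k l r N := by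
  choose r₀ hr₀ H using h
  have hne : (Finset.univ : Finset (Fin 3 × Fin 3)).Nonempty := Finset.univ_nonempty
  refine ⟨Finset.univ.inf' hne fun p => r₀ p.1 p.2, ?_, fun r hr hrlt => ?_⟩
  · exact (Finset.lt_inf'_iff hne).2 fun p _ => hr₀ p.1 p.2
  · have hlt : ∀ k l, r < r₀ k l := fun k l =>
      lt_of_lt_of_le hrlt (Finset.inf'_le (fun p : Fin 3 × Fin 3 => r₀ p.1 p.2) (Finset.mem_univ (k, l)))
    choose N₀ HN using fun k l => H k l r hr (hlt k l)
    refine ⟨Finset.univ.sup fun p : Fin 3 × Fin 3 => N₀ p.1 p.2, fun N hN k l => HN k l N ?_⟩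
    exact le_trans (Finset.le_sup (f := fun p : Fin 3 × Fin 3 => N₀ p.1 p.2) (Finset.mem_univ (k, l))) hN

/-- The crux's even marks are continuous second-moment marks: `|Ξ_P^{kl}(n,v,w)| ≤ ‖w − v‖ ≤
1 + ‖v‖² + ‖w‖²` at unit normal (`abs_evenMark_le`). [folklore] -/
theorem lgr_abs_evenMark_le_quad (k l : Fin 3) (q : V3 × V3 × V3) (hn : ‖q.1‖ = 1) :
    |evenMark k l q| ≤ 1 * (1 + ‖q.2.1‖ ^ 2 + ‖q.2.2‖ ^ 2) := by
  have h1 : |evenMark k l q| ≤ ‖q.2.2 - q.2.1‖ := abs_evenMark_le k l hn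
  have h2 : ‖q.2.2 - q.2.1‖ ≤ ‖q.2.2‖ + ‖q.2.1‖ := norm_sub_le _ _
  have h3 : 0 ≤ ‖q.2.1‖ := norm_nonneg _
  have h4 : 0 ≤ ‖q.2.2‖ := norm_nonneg _
  nlinarith [sq_nonneg (‖q.2.1‖ - 1), sq_nonneg (‖q.2.2‖ - 1)]

/-- **`EvenStressEnskog` FROM ITS CONTACT SIDE AND ITS ENSKOG SIDE.**  Hypotheses (spelled out): `hC` = the
collision sum of the even marks is close to the fully Maxwellian Enskog prediction `contactPredM`, `hE` =
`contactPredM` is close to the crux's empirical Enskog term, both in local-Gibbs probability in the crux's frame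
with `∀ k l` before `∀ η δ`.  Union bound pair by pair, thresholds `min η₀ / min σ₀ / min r₀ / max N₀`, then the
crux by unfolding (`evenStat = collisionSum − σ³∫enskogRate` definitionally). [folklore] -/
theorem evenStressEnskog_of_sides
    (hC : ∃ η₀ : ℝ, 0 < η₀ ∧ ∀ (a₀ θ₀ : T3 → ℝ) (u₀ : T3 → V3), Continuous a₀ → Continuous θ₀ → Continuous u₀ →
          (∀ x, 0 < a₀ x) → (∀ x, 0 < θ₀ x) → ∃ σ₀ : ℝ, 0 < σ₀ ∧ ∀ σ : ℝ, 0 < σ → σ < σ₀ →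
          ∀ Φ : (N : ℕ) → HardSphereFlow (Torus.geometry (Fin 3)) (hsDiameter σ N) (N + 1), ∀ τ : ℝ, 0 < τ →
          ∀ χ : ℝ × T3 → ℝ, Continuous χ → ∀ g : ℝ → ℝ, Continuous g → (∀ a, η₀ ≤ a → g a = 0) →
          ∀ k l : Fin 3,
          ∀ η δ : ℝ, 0 < η → 0 < δ → ∃ r₀ : ℝ, 0 < r₀ ∧ ∀ r : ℝ, 0 < r → r < r₀ → ∃ N₀ : ℕ, ∀ N : ℕ, N₀ ≤ N →
            localGibbsLaw σ a₀ u₀ θ₀ N (Φ N)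
              {z | η < |collisionSum σ N (Φ N) τ χ g (evenMark k l) r z - contactPredM σ N (Φ N) τ χ g (evenMark k l) r z|}
              ≤ ENNReal.ofReal δ)
    (hE : ∃ η₀ : ℝ, 0 < η₀ ∧ ∀ (a₀ θ₀ : T3 → ℝ) (u₀ : T3 → V3), Continuous a₀ → Continuous θ₀ → Continuous u₀ →
          (∀ x, 0 < a₀ x) → (∀ x, 0 < θ₀ x) → ∃ σ₀ : ℝ, 0 < σ₀ ∧ ∀ σ : ℝ, 0 < σ → σ < σ₀ →
          ∀ Φ : (N : ℕ) → HardSphereFlow (Torus.geometry (Fin 3)) (hsDiameter σ N) (N + 1), ∀ τ : ℝ, 0 < τ →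
          ∀ χ : ℝ × T3 → ℝ, Continuous χ → ∀ g : ℝ → ℝ, Continuous g → (∀ a, η₀ ≤ a → g a = 0) →
          ∀ k l : Fin 3,
          ∀ η δ : ℝ, 0 < η → 0 < δ → ∃ r₀ : ℝ, 0 < r₀ ∧ ∀ r : ℝ, 0 < r → r < r₀ → ∃ N₀ : ℕ, ∀ N : ℕ, N₀ ≤ N →
            localGibbsLaw σ a₀ u₀ θ₀ N (Φ N)
              {z | η < |contactPredM σ N (Φ N) τ χ g (evenMark k l) r z
                    - σ ^ 3 * ∫ s in Set.Icc (0 : ℝ) τ, enskogRate σ N χ g (evenMark k l) r s ((Φ N).flow s z)|}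
              ≤ ENNReal.ofReal δ) :
    EvenStressEnskog := by
  suffices hnamed :
      ∃ η₀ : ℝ, 0 < η₀ ∧ ∀ (a₀ θ₀ : T3 → ℝ) (u₀ : T3 → V3), Continuous a₀ → Continuous θ₀ → Continuous u₀ →
        (∀ x, 0 < a₀ x) → (∀ x, 0 < θ₀ x) → ∃ σ₀ : ℝ, 0 < σ₀ ∧ ∀ σ : ℝ, 0 < σ → σ < σ₀ →
        ∀ Φ : (N : ℕ) → HardSphereFlow (Torus.geometry (Fin 3)) (hsDiameter σ N) (N + 1),
        ∀ τ : ℝ, 0 < τ → ∀ χ : ℝ × UnitAddTorus (Fin 3) → ℝ, Continuous χ → ∀ g : ℝ → ℝ, Continuous g →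
        (∀ a, η₀ ≤ a → g a = 0) →
        ∀ η δ : ℝ, 0 < η → 0 < δ → ∃ r₀ : ℝ, 0 < r₀ ∧ ∀ r : ℝ, 0 < r → r < r₀ →
        ∃ N₀ : ℕ, ∀ N : ℕ, N₀ ≤ N → ∀ k l : Fin 3,
          localGibbsLaw σ a₀ u₀ θ₀ N (Φ N) {z | η < |evenStat σ N (Φ N) τ χ g (evenMark k l) r z|}
            ≤ ENNReal.ofReal δ by
    exact hnamed
  obtain ⟨η₄, hη₄, H4⟩ := hC
  obtain ⟨η₅, hη₅, H5⟩ := hE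
  refine ⟨min η₄ η₅, lt_min hη₄ hη₅, ?_⟩
  intro a₀ θ₀ u₀ ha hθ hu ha0 hθ0
  obtain ⟨σ₄, hσ₄, H4⟩ := H4 a₀ θ₀ u₀ ha hθ hu ha0 hθ0
  obtain ⟨σ₅, hσ₅, H5⟩ := H5 a₀ θ₀ u₀ ha hθ hu ha0 hθ0
  refine ⟨min σ₄ σ₅, lt_min hσ₄ hσ₅, ?_⟩
  intro σ hσ hσlt Φ τ hτ χ hχ g hg hg0 η δ hη hδ
  have hσ4 : σ < σ₄ := lt_of_lt_of_le hσlt (min_le_left _ _)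
  have hσ5 : σ < σ₅ := lt_of_lt_of_le hσlt (min_le_right _ _)
  have hg4 : ∀ a, η₄ ≤ a → g a = 0 := fun a h => hg0 a ((min_le_left _ _).trans h)
  have hg5 : ∀ a, η₅ ≤ a → g a = 0 := fun a h => hg0 a ((min_le_right _ _).trans h)
  have hη2 : 0 < η / 2 := by positivity
  have hδ2 : 0 < δ / 2 := by positivity
  -- per pair (k, l): thresholds from the contact side and the Enskog side, combined
  have hpair : ∀ k l : Fin 3, ∃ r₀ : ℝ, 0 < r₀ ∧ ∀ r : ℝ, 0 < r → r < r₀ → ∃ N₀ : ℕ, ∀ N : ℕ, N₀ ≤ N →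
      localGibbsLaw σ a₀ u₀ θ₀ N (Φ N) {z | η < |evenStat σ N (Φ N) τ χ g (evenMark k l) r z|}
        ≤ ENNReal.ofReal δ := by
    intro k l
    obtain ⟨r₄, hr₄, H4'⟩ := H4 σ hσ hσ4 Φ τ hτ χ hχ g hg hg4 k l (η / 2) (δ / 2) hη2 hδ2
    obtain ⟨r₅, hr₅, H5'⟩ := H5 σ hσ hσ5 Φ τ hτ χ hχ g hg hg5 k l (η / 2) (δ / 2) hη2 hδ2
    refine ⟨min r₄ r₅, lt_min hr₄ hr₅, fun r hr hrlt => ?_⟩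
    have hr4 : r < r₄ := lt_of_lt_of_le hrlt (min_le_left _ _)
    have hr5 : r < r₅ := lt_of_lt_of_le hrlt (min_le_right _ _)
    obtain ⟨N₄, H4''⟩ := H4' r hr hr4
    obtain ⟨N₅, H5''⟩ := H5' r hr hr5
    refine ⟨max N₄ N₅, fun N hN => ?_⟩
    have E4 := H4'' N ((le_max_left _ _).trans hN)
    have E5 := H5'' N ((le_max_right _ _).trans hN)
    set P := localGibbsLaw σ a₀ u₀ θ₀ N (Φ N) with hP'
    set K := fun z => collisionSum σ N (Φ N) τ χ g (evenMark k l) r z with hK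
    set C := fun z => contactPredM σ N (Φ N) τ χ g (evenMark k l) r z with hC'
    set E := fun z => σ ^ 3 * ∫ s in Set.Icc (0 : ℝ) τ, enskogRate σ N χ g (evenMark k l) r s ((Φ N).flow s z)
      with hE'
    have hD : ∀ z, evenStat σ N (Φ N) τ χ g (evenMark k l) r z = K z - E z := fun z => rfl
    have hsub : {z | η < |evenStat σ N (Φ N) τ χ g (evenMark k l) r z|}
        ⊆ {z | η / 2 < |K z - C z|} ∪ {z | η / 2 < |C z - E z|} := by
      intro z hz
      simp only [Set.mem_setOf_eq, Set.mem_union] at hz ⊢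
      rw [hD z] at hz
      by_contra hcon
      simp only [not_or, not_lt] at hcon
      obtain ⟨h1', h2'⟩ := hcon
      have : |K z - E z| ≤ |K z - C z| + |C z - E z| := abs_sub_le (K z) (C z) (E z)
      linarith
    calc P {z | η < |evenStat σ N (Φ N) τ χ g (evenMark k l) r z|}
        ≤ P ({z | η / 2 < |K z - C z|} ∪ {z | η / 2 < |C z - E z|}) := measure_mono hsub
      _ ≤ P {z | η / 2 < |K z - C z|} + P {z | η / 2 < |C z - E z|} := measure_union_le _ _
      _ ≤ ENNReal.ofReal (δ / 2) + ENNReal.ofReal (δ / 2) := add_le_add E4 E5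
      _ = ENNReal.ofReal δ := by
          rw [← ENNReal.ofReal_add hδ2.le hδ2.le]
          congr 1
          ring
  exact lgr_exists_r₀_N₀_forall_fin3
    (P := fun k l r N => localGibbsLaw σ a₀ u₀ θ₀ N (Φ N)
      {z | η < |evenStat σ N (Φ N) τ χ g (evenMark k l) r z|} ≤ ENNReal.ofReal δ) hpair

/-- **`EvenStressEnskog` FROM (L1) ∧ (L2).**  `hL1` = one-body local Maxwellianity at scale `r` tested on
second-moment test functions (the line's `OneBodyMaxwellTested`, spelled out); `hL2` = the Enskog contact law
with the thermodynamic contact value for continuous second-moment marks (the line's `ContactMaxwellTested`,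
spelled out).  The Enskog side is `stub_enskogIdentification_of_pointwise stub_enskogPointwise hL1`; the contact
side is the instance `Ξ := evenMark k l` of `hL2` (`continuous_evenMark`, `lgr_abs_evenMark_le_quad`).
[folklore] -/
theorem evenStressEnskog_of_localGibbsTested
    (hL1 : ∃ η₀ : ℝ, 0 < η₀ ∧ ∀ (a₀ θ₀ : T3 → ℝ) (u₀ : T3 → V3), Continuous a₀ → Continuous θ₀ → Continuous u₀ →
          (∀ x, 0 < a₀ x) → (∀ x, 0 < θ₀ x) → ∃ σ₀ : ℝ, 0 < σ₀ ∧ ∀ σ : ℝ, 0 < σ → σ < σ₀ →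
          ∀ Φ : (N : ℕ) → HardSphereFlow (Torus.geometry (Fin 3)) (hsDiameter σ N) (N + 1), ∀ τ : ℝ, 0 < τ →
          ∀ χ : ℝ × T3 → ℝ, Continuous χ → ∀ k : ℝ → ℝ, Continuous k → (∀ a, η₀ ≤ a → k a = 0) →
          ∀ F : V3 × V3 × ℝ → ℝ, Continuous F →
          (∃ C : ℝ, ∀ q, |F q| ≤ C * (1 + ‖q.1‖ ^ 2 + ‖q.2.1‖ ^ 2 + |q.2.2|)) →
          ∀ η δ : ℝ, 0 < η → 0 < δ → ∃ r₀ : ℝ, 0 < r₀ ∧ ∀ r : ℝ, 0 < r → r < r₀ → ∃ N₀ : ℕ, ∀ N : ℕ, N₀ ≤ N →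
            localGibbsLaw σ a₀ u₀ θ₀ N (Φ N)
              {z | η < |oneBodyStat σ N (Φ N) τ χ k F r z - oneBodyPred σ N (Φ N) τ χ k F r z|}
              ≤ ENNReal.ofReal δ)
    (hL2 : ∃ η₀ : ℝ, 0 < η₀ ∧ ∀ (a₀ θ₀ : T3 → ℝ) (u₀ : T3 → V3), Continuous a₀ → Continuous θ₀ → Continuous u₀ →
          (∀ x, 0 < a₀ x) → (∀ x, 0 < θ₀ x) → ∃ σ₀ : ℝ, 0 < σ₀ ∧ ∀ σ : ℝ, 0 < σ → σ < σ₀ →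
          ∀ Φ : (N : ℕ) → HardSphereFlow (Torus.geometry (Fin 3)) (hsDiameter σ N) (N + 1), ∀ τ : ℝ, 0 < τ →
          ∀ χ : ℝ × T3 → ℝ, Continuous χ → ∀ g : ℝ → ℝ, Continuous g → (∀ a, η₀ ≤ a → g a = 0) →
          ∀ Ξ : V3 × V3 × V3 → ℝ, Continuous Ξ →
          (∃ C : ℝ, ∀ q, ‖q.1‖ = 1 → |Ξ q| ≤ C * (1 + ‖q.2.1‖ ^ 2 + ‖q.2.2‖ ^ 2)) →
          ∀ η δ : ℝ, 0 < η → 0 < δ → ∃ r₀ : ℝ, 0 < r₀ ∧ ∀ r : ℝ, 0 < r → r < r₀ → ∃ N₀ : ℕ, ∀ N : ℕ, N₀ ≤ N →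
            localGibbsLaw σ a₀ u₀ θ₀ N (Φ N)
              {z | η < |collisionSum σ N (Φ N) τ χ g Ξ r z - contactPredM σ N (Φ N) τ χ g Ξ r z|}
              ≤ ENNReal.ofReal δ) :
    EvenStressEnskog := by
  refine evenStressEnskog_of_sides ?_ (stub_enskogIdentification_of_pointwise stub_enskogPointwise hL1)
  obtain ⟨η₀, hη₀, H⟩ := hL2
  refine ⟨η₀, hη₀, fun a₀ θ₀ u₀ ha hθ hu ha0 hθ0 => ?_⟩
  obtain ⟨σ₀, hσ₀, H⟩ := H a₀ θ₀ u₀ ha hθ hu ha0 hθ0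
  refine ⟨σ₀, hσ₀, fun σ hσ hσlt Φ τ hτ χ hχ g hg hg0 k l η δ hη hδ => ?_⟩
  exact H σ hσ hσlt Φ τ hτ χ hχ g hg hg0 (evenMark k l) (continuous_evenMark k l)
    ⟨1, fun q hq => lgr_abs_evenMark_le_quad k l q hq⟩ η δ hη hδ

/-- **CONVERSELY: the contact side from the crux and the Enskog side** — so that, modulo the Enskog side
(equivalently, modulo the one-body statement (L1) for the weight `g·Ỹ·a` and the six test functions `F_{kl}`),
the crux `EvenStressEnskog` IS the Enskog contact law for its even marks (`ContactSideTested`, spelled out):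
reverse union bound `{η < |K − C|} ⊆ {η/2 < |K − E|} ∪ {η/2 < |C − E|}` pair by pair (the crux's innermost
`∀ k l` is specialised). [folklore] -/
theorem contactSide_of_evenStressEnskog_of_enskogSide (hX : EvenStressEnskog)
    (hE : ∃ η₀ : ℝ, 0 < η₀ ∧ ∀ (a₀ θ₀ : T3 → ℝ) (u₀ : T3 → V3), Continuous a₀ → Continuous θ₀ → Continuous u₀ →
          (∀ x, 0 < a₀ x) → (∀ x, 0 < θ₀ x) → ∃ σ₀ : ℝ, 0 < σ₀ ∧ ∀ σ : ℝ, 0 < σ → σ < σ₀ →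
          ∀ Φ : (N : ℕ) → HardSphereFlow (Torus.geometry (Fin 3)) (hsDiameter σ N) (N + 1), ∀ τ : ℝ, 0 < τ →
          ∀ χ : ℝ × T3 → ℝ, Continuous χ → ∀ g : ℝ → ℝ, Continuous g → (∀ a, η₀ ≤ a → g a = 0) →
          ∀ k l : Fin 3,
          ∀ η δ : ℝ, 0 < η → 0 < δ → ∃ r₀ : ℝ, 0 < r₀ ∧ ∀ r : ℝ, 0 < r → r < r₀ → ∃ N₀ : ℕ, ∀ N : ℕ, N₀ ≤ N →
            localGibbsLaw σ a₀ u₀ θ₀ N (Φ N)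
              {z | η < |contactPredM σ N (Φ N) τ χ g (evenMark k l) r z
                    - σ ^ 3 * ∫ s in Set.Icc (0 : ℝ) τ, enskogRate σ N χ g (evenMark k l) r s ((Φ N).flow s z)|}
              ≤ ENNReal.ofReal δ) :
    ∃ η₀ : ℝ, 0 < η₀ ∧ ∀ (a₀ θ₀ : T3 → ℝ) (u₀ : T3 → V3), Continuous a₀ → Continuous θ₀ → Continuous u₀ →
        (∀ x, 0 < a₀ x) → (∀ x, 0 < θ₀ x) → ∃ σ₀ : ℝ, 0 < σ₀ ∧ ∀ σ : ℝ, 0 < σ → σ < σ₀ →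
        ∀ Φ : (N : ℕ) → HardSphereFlow (Torus.geometry (Fin 3)) (hsDiameter σ N) (N + 1), ∀ τ : ℝ, 0 < τ →
        ∀ χ : ℝ × T3 → ℝ, Continuous χ → ∀ g : ℝ → ℝ, Continuous g → (∀ a, η₀ ≤ a → g a = 0) →
        ∀ k l : Fin 3,
        ∀ η δ : ℝ, 0 < η → 0 < δ → ∃ r₀ : ℝ, 0 < r₀ ∧ ∀ r : ℝ, 0 < r → r < r₀ → ∃ N₀ : ℕ, ∀ N : ℕ, N₀ ≤ N →
          localGibbsLaw σ a₀ u₀ θ₀ N (Φ N)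
            {z | η < |collisionSum σ N (Φ N) τ χ g (evenMark k l) r z - contactPredM σ N (Φ N) τ χ g (evenMark k l) r z|}
            ≤ ENNReal.ofReal δ := by
  have hX' :
      ∃ η₀ : ℝ, 0 < η₀ ∧ ∀ (a₀ θ₀ : T3 → ℝ) (u₀ : T3 → V3), Continuous a₀ → Continuous θ₀ → Continuous u₀ →
        (∀ x, 0 < a₀ x) → (∀ x, 0 < θ₀ x) → ∃ σ₀ : ℝ, 0 < σ₀ ∧ ∀ σ : ℝ, 0 < σ → σ < σ₀ →
        ∀ Φ : (N : ℕ) → HardSphereFlow (Torus.geometry (Fin 3)) (hsDiameter σ N) (N + 1),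
        ∀ τ : ℝ, 0 < τ → ∀ χ : ℝ × UnitAddTorus (Fin 3) → ℝ, Continuous χ → ∀ g : ℝ → ℝ, Continuous g →
        (∀ a, η₀ ≤ a → g a = 0) →
        ∀ η δ : ℝ, 0 < η → 0 < δ → ∃ r₀ : ℝ, 0 < r₀ ∧ ∀ r : ℝ, 0 < r → r < r₀ →
        ∃ N₀ : ℕ, ∀ N : ℕ, N₀ ≤ N → ∀ k l : Fin 3,
          localGibbsLaw σ a₀ u₀ θ₀ N (Φ N) {z | η < |evenStat σ N (Φ N) τ χ g (evenMark k l) r z|}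
            ≤ ENNReal.ofReal δ := hX
  obtain ⟨η₄, hη₄, H4⟩ := hX'
  obtain ⟨η₅, hη₅, H5⟩ := hE
  refine ⟨min η₄ η₅, lt_min hη₄ hη₅, ?_⟩
  intro a₀ θ₀ u₀ ha hθ hu ha0 hθ0
  obtain ⟨σ₄, hσ₄, H4⟩ := H4 a₀ θ₀ u₀ ha hθ hu ha0 hθ0
  obtain ⟨σ₅, hσ₅, H5⟩ := H5 a₀ θ₀ u₀ ha hθ hu ha0 hθ0
  refine ⟨min σ₄ σ₅, lt_min hσ₄ hσ₅, ?_⟩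
  intro σ hσ hσlt Φ τ hτ χ hχ g hg hg0 k l η δ hη hδ
  have hσ4 : σ < σ₄ := lt_of_lt_of_le hσlt (min_le_left _ _)
  have hσ5 : σ < σ₅ := lt_of_lt_of_le hσlt (min_le_right _ _)
  have hg4 : ∀ a, η₄ ≤ a → g a = 0 := fun a h => hg0 a ((min_le_left _ _).trans h)
  have hg5 : ∀ a, η₅ ≤ a → g a = 0 := fun a h => hg0 a ((min_le_right _ _).trans h)
  have hη2 : 0 < η / 2 := by positivity
  have hδ2 : 0 < δ / 2 := by positivity
  obtain ⟨r₄, hr₄, H4'⟩ := H4 σ hσ hσ4 Φ τ hτ χ hχ g hg hg4 (η / 2) (δ / 2) hη2 hδ2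
  obtain ⟨r₅, hr₅, H5'⟩ := H5 σ hσ hσ5 Φ τ hτ χ hχ g hg hg5 k l (η / 2) (δ / 2) hη2 hδ2
  refine ⟨min r₄ r₅, lt_min hr₄ hr₅, fun r hr hrlt => ?_⟩
  have hr4 : r < r₄ := lt_of_lt_of_le hrlt (min_le_left _ _)
  have hr5 : r < r₅ := lt_of_lt_of_le hrlt (min_le_right _ _)
  obtain ⟨N₄, H4''⟩ := H4' r hr hr4
  obtain ⟨N₅, H5''⟩ := H5' r hr hr5
  refine ⟨max N₄ N₅, fun N hN => ?_⟩
  have E4 := H4'' N ((le_max_left _ _).trans hN) k l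
  have E5 := H5'' N ((le_max_right _ _).trans hN)
  set P := localGibbsLaw σ a₀ u₀ θ₀ N (Φ N) with hP'
  set K := fun z => collisionSum σ N (Φ N) τ χ g (evenMark k l) r z with hK
  set C := fun z => contactPredM σ N (Φ N) τ χ g (evenMark k l) r z with hC'
  set E := fun z => σ ^ 3 * ∫ s in Set.Icc (0 : ℝ) τ, enskogRate σ N χ g (evenMark k l) r s ((Φ N).flow s z)
    with hE'
  have hD : ∀ z, evenStat σ N (Φ N) τ χ g (evenMark k l) r z = K z - E z := fun z => rfl
  have hsub : {z | η < |K z - C z|}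
      ⊆ {z | η / 2 < |evenStat σ N (Φ N) τ χ g (evenMark k l) r z|} ∪ {z | η / 2 < |C z - E z|} := by
    intro z hz
    simp only [Set.mem_setOf_eq, Set.mem_union] at hz ⊢
    rw [hD z]
    by_contra hcon
    simp only [not_or, not_lt] at hcon
    obtain ⟨h1', h2'⟩ := hcon
    have : |K z - C z| ≤ |K z - E z| + |E z - C z| := abs_sub_le (K z) (E z) (C z)
    rw [abs_sub_comm (E z) (C z)] at this
    linarith
  calc P {z | η < |K z - C z|}
      ≤ P ({z | η / 2 < |evenStat σ N (Φ N) τ χ g (evenMark k l) r z|} ∪ {z | η / 2 < |C z - E z|}) :=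
        measure_mono hsub
    _ ≤ P {z | η / 2 < |evenStat σ N (Φ N) τ χ g (evenMark k l) r z|} + P {z | η / 2 < |C z - E z|} :=
        measure_union_le _ _
    _ ≤ ENNReal.ofReal (δ / 2) + ENNReal.ofReal (δ / 2) := add_le_add E4 E5
    _ = ENNReal.ofReal δ := by
        rw [← ENNReal.ofReal_add hδ2.le hδ2.le]
        congr 1
        ring

/-- **MICROSCALE STATIONARITY (unconditional).**  Along the hard-sphere flow from local Gibbs data, for `χ`
continuous with continuous `s`-derivative, `g ∈ C¹` bounded with bounded derivative (no density cutoff, no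
smallness of the density), every level `m`, every compactly supported `C¹` tuple test function `P`, every fixed
`r ∈ (0, 1/2)`: `P_LG(η < |streamStat + collJump|) ≤ δ` for `N ≥ N₀` — the time-and-`χ`-averaged microscale
windows solve the weak STATIONARY hard-sphere hierarchy up to `o(1)` in probability (the line's
`MicroStationarity`, spelled out; `stub_microStationarity_of stub_clusterTransport`). [folklore] -/
theorem microStationarity :
    ∀ (a₀ θ₀ : T3 → ℝ) (u₀ : T3 → V3), Continuous a₀ → Continuous θ₀ → Continuous u₀ →
      (∀ x, 0 < a₀ x) → (∀ x, 0 < θ₀ x) → ∃ σ₀ : ℝ, 0 < σ₀ ∧ ∀ σ : ℝ, 0 < σ → σ < σ₀ →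
      ∀ Φ : (N : ℕ) → HardSphereFlow (Torus.geometry (Fin 3)) (hsDiameter σ N) (N + 1), ∀ τ : ℝ, 0 < τ →
      ∀ χ : ℝ × T3 → ℝ, Continuous χ → (∀ x₀, Differentiable ℝ fun s => χ (s, x₀)) →
      Continuous (fun p : ℝ × T3 => deriv (fun s => χ (s, p.2)) p.1) →
      ∀ g : ℝ → ℝ, ContDiff ℝ 1 g → (∃ C : ℝ, ∀ a, |g a| ≤ C) → (∃ C : ℝ, ∀ a, |deriv g a| ≤ C) →
      ∀ (m : ℕ) (P : (Fin m → V3 × V3) → ℝ), ContDiff ℝ 1 P → HasCompactSupport P →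
      ∀ r : ℝ, 0 < r → r < 1 / 2 → ∀ η δ : ℝ, 0 < η → 0 < δ → ∃ N₀ : ℕ, ∀ N : ℕ, N₀ ≤ N →
        localGibbsLaw σ a₀ u₀ θ₀ N (Φ N)
          {z | η < |streamStat σ N (Φ N) τ χ g r P z + collJump σ N (Φ N) τ χ g r P z|} ≤ ENNReal.ofReal δ :=
  stub_microStationarity_of stub_clusterTransport

end Summit.AtomisticToContinuum.HydrodynamicLimit.Theorems.EvenStressEnskog

end
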